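import Mathlib.Analysis.SpecialFunctions.Pow.Real
import Mathlib.Algebra.BigOperators.Finprod
import Mathlib.Algebra.Order.BigOperators.GroupWithZero.Finset
import Mathlib.Data.EReal.Basic
import Mathlib.Topology.Order.Compact
import HarnessLib

/-!
# [J-III] §7.1–7.4: Joshi's fundamental theta-values estimate for `Θ̃^{B_{L′}}_Joshi` (typed, NOT asserted)

Block E of the abc-iut cell (rung LADDER-ABC:A2.E), seat abc-iut-E-t12, slot T-12 = plan/E/OBJECTS.tsv row O-024;
node ids J3:Def7.2.1, J3:Lem7.2.4, J3:Rmk7.2.5, J3:Def7.2.7, J3:Rmk7.2.10, J3:Thm7.3.1, J3:Cor7.4.1, J3:Cor7.4.2 of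
plan/E/JOSHI-DAG.tsv. SOURCE: K. Joshi, *Construction of Arithmetic Teichmüller Spaces III: A 'Rosetta Stone' and a
proof of Mochizuki's Corollary 3.12*, arXiv:2401.13508**v4** (unrefereed, "Preliminary version for comments"; bib
`Joshi2024ATS3`), §7 "Proof of Mochizuki's Corollary 3.12 for `Θ̃^{B_{L′}}_Joshi`", §7.1–7.4 = printed pp. 53–57.
Locators «p.N l.a–b» = PDF page N, line a–b of the cell's render `HOME/lit/renders/Joshi-arxiv-2401.13508/pNNNN.txt`
(printed page = PDF page − 1). The one-prime prototype is [J-IIp] = arXiv:2303.01662v3 (bib `Joshi2023ATS2Local`).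

FRAMING (binding): this file TYPES a third party's unrefereed construction so that it can be TESTED against the cell's
residual `S = Summit.ABC.IUTFork.Cor312Vol.PilotKummerIndRelated`; it takes NO side on [IUTchIII] Cor. 3.12, on
Joshi's claims, or on Mochizuki's 2024 report on them; typed ≠ proved; typed AS A CANDIDATE ≠ endorsed; nothing
here bears on abc. Every statement Joshi ASSERTS is a `Prop`-valued `def` tagged `@[claim "Joshi2024ATS3" "disputed"]`
("disputed" = the registered HarnessLib status word recording that a dispute exists in print, `Mochizuki2024JoshiReport`)
— never an axiom, instance, `sorry` or Literature fact. Every `theorem` below is DERIVED over the typed signature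
(bookkeeping: it checks that a printed step reduces exactly to the named printed hypotheses).

JOSHI'S OWN SCOPING OF §7 (p.53 l.32–38, verbatim): "Now the stage is set for proving my version of the fundamental
estimate known as of Mochizuki's Corollary 3.12. A prototype version of which was established in [Joshi, 2023b,
Theorem 9.2.1]. The version proved here works in the number field setting and exhibits all features of [Mochizuki,
2021c, Corollary 3.12] except for the fact that I work with the ring `B_{L′}` defined above. Mochizuki's version works
with Galois cohomology groups and will be established in § 9." Hence NO object of OUR multiradial representation
(`Thm311.LogShells.Packet`, `Cor312.Setting`, the (Ind1)/(Ind2)/(Ind3) families) occurs in §7.1–7.4: the §7 chain is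
a PARALLEL chain (plan class P2); its dictionary to tensor packets is Joshi's §9 (slots T-19…T-23, E-t4).

INTERIM CARRIER RULE (plan/E/ASSIGNMENTS.md §0.3): no Joshi vocabulary has landed yet, so this file is
SELF-CONTAINED over the abstract signature `AdelicThetaDatum` = exactly what §7.1–7.4 READS from §§3–6, each field
with its locator. MERGE-DEBT: J3:§6.5–6.10 (`B_{L′}`, Def 6.10.2, (6.5.1), Lem 6.5.2) = slot T-11 (E-t11,
`ThetaJoshiAdelic.lean`); norms `|·|_ρ`, `B^+` = T-09 / E-t3 `PeriodRing.lean`; admissible lifts Def 6.4.3.1 = T-10;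
standard point `z_Θ` (§4.4–4.5) = T-08; `ℓ`, `V^{odd,ss}` (§3.3–3.4) = T-06. When those land, this Datum is re-keyed
to theirs by an explicit projection (a `def`, reviewed), not by restating.

OUR-SIDE COMPARISON (analogues only; nothing is bound here — binding is the Dictionary file's job, E-PLAN R4b):
Thm 7.3.1's CONCLUSION has the shape of `Summit.ABC.IUTFork.Cor312.Setting.Statement` ("`−|log(q)| ≤ −|log(Θ)|`");
its printed MECHANISM — ONE exhibited element `Ξ^α_{0,z_Θ}` of the locus dominates the q-quantity, which enters only
as the NUMBER `∏_w |q_w|^{ℓ*/2ℓ}` — has the shape of `Summit.ABC.IUTFork.Cor312Vol.VolumeTransport`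
(`theorem fundamentalEstimateBL_of_localThetaEstimateAt` below is exactly that reduction), NOT the shape of `S`
(no q-pilot Kummer datum, no `⟨Ind1 ∪ Ind2⟩`-translate, no region identity occurs). Test shape = VolumeTransport
(E-PLAN ruling R2; test file X-05 is separate and waits for the E-cx sign-off).

FAITHFULNESS FLAGS recorded for the referee lanes (E-ref), not adjudicated: (F-a) Thm 7.3.1 is stated without
"`ℓ ≫ 0`" but its proof's local step is "for `ℓ ≫ 0`" (p.56 l.47); (F-b) Cor 7.4.2 AS PRINTED lacks the exponent `ℓ*`
of its cited source Thm 7.3.1 (both forms typed, `cor742_of_asPrinted` proved); (F-c) Def 7.2.7 takes `ρ ∈ (0,1]`,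
the proof of Cor 7.4.1 takes `sup_{0<ρ<1}`; (F-d) the uniform-in-`ρ` bound in the proof of Cor 7.4.1 ("evidently
bounded", p.57 l.7–8) is typed as the hypothesis `UniformNormBound` — at each FIXED `ρ` the bound IS derived here from
precompactness (`sizeAt_pi_lt_top`). FILE SPLIT (≤ 400 lines, D-0064): THIS file = signature, Def. 7.2.1, Lem. 7.2.4,
Rmk. 7.2.5, Def. 7.2.7, Thm. 7.3.1; the companion `Joshi/FundamentalEstimateBLCorollaries.lean` = §7.4 (special
precompact subsets), Cor. 7.4.1, Cor. 7.4.2 (flags (F-b)–(F-d) live there). Deliberately NOT here: §7.5–7.9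
(T-13/T-14/T-15), §9, any test vs `S`, any judgement.
-/

noncomputable section

open Set Finset

namespace Summit.ABC.IUTFork.Joshi.ATS3

/-! ## 1. The signature §7.1–7.4 reads from §§3–6 (J3:§7.2-sig) -/

/-- **The adelic theta-values signature** read by [J-III] §7.1–7.4 ("Throughout this section, the assumptions and
notational conventions of § 2.4 and § 3.1, § 3.3 will be in force", p.53 l.39–40). Data only, plus the three
elementary facts §7 invokes by citation ((6.5.1)/Lem. 6.5.2 "`|[1]|_{B_E,ρ} = 1`", non-negativity of the norms of
[Fargues–Fontaine 2018, Déf. 1.10.2], and `0 < |q_w|_{C_{p_w}} < 1` for a Tate parameter); NOTHING of §7 is asserted.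
Interim self-contained carrier (merge-debt T-11/T-09/T-08/T-06, module docstring).
[claim: Joshi2024ATS3, status: disputed] -/
structure AdelicThetaDatum : Type 1 where
  /-- `𝕍_{L′}`: the set of primes of the field `L′` of §3.3 (13) (type of). [J-III] §3.4, p.28 l.22–33. -/
  W : Type
  /-- `𝕍^{odd,ss} ⊂ 𝕍_{L′}`: the chosen primes of odd residue characteristic where `X` has split multiplicative
  reduction — a FINITE set ([J-III] §3.4 p.28 l.31–33; finiteness used at p.55 l.31–35 "The set of such rational
  primes `p` is finite … hence the product in the assertion is finite"). -/
  Vss : Finset W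
  /-- `ℓ* = (ℓ − 1)/2` for the prime `ℓ ≥ 5` of §3.3 (11), p.28 l.5–7 (so `ℓ = 2ℓ* + 1`, cf. `ell`). -/
  lstar : ℕ
  /-- §3.3 (11): "`ℓ ≥ 5`", i.e. `2 ≤ ℓ*`. -/
  two_le_lstar : 2 ≤ lstar
  /-- §3.3 (11): "Let `ℓ ≥ 5` be a prime number". -/
  prime_ell : (2 * lstar + 1).Prime
  /-- the local Fargues–Fontaine rings `B_{L′_w}` (`= B_{E′_w}`, `E′_w = L′_w`, Thm. 6.7.1.1 p.51 l.2–5), factors of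
  the adelic ring `B_{L′} = ∏_{w ∈ 𝕍_{L′}} B_{L′_w}` ([J-III] (6.9.1.1) p.52 l.17–22; [Joshi 2023a, Def. 4.5.1]). -/
  B : W → Type
  /-- the Teichmüller element `[1] ∈ W(𝒪_{C^♭_p}) ⊂ B_E` ([J-III] (6.5.1), p.48 l.17–21). -/
  one : ∀ w, B w
  /-- the norms `|−|_{B_{L′_w},ρ}`, `ρ ∈ (0, 1] ⊂ ℝ`, "given by [Fargues and Fontaine, 2018, Définition 1.10.2]"
  ([J-III] p.54 l.19–23); a real number for every real `ρ` (only `ρ ∈ (0,1]` is ever read). -/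
  nrm : ∀ w, ℝ → B w → ℝ
  /-- norms are non-negative ([FF18] Déf. 1.10.2). -/
  nrm_nonneg : ∀ w ρ x, 0 ≤ nrm w ρ x
  /-- [J-III] Lem. 6.5.2, p.48 l.22–25: "For each `ρ ∈ (0, 1) ⊂ ℝ` one has `|[1]|_{B_E,ρ} = 1`. Proof. Clear from
  [Fargues and Fontaine, 2018, Chapitre 1, Définition 1.4.1]" (read at every `ρ`, as p.56 l.5 does: "for any
  `ρ ∈ [0, 1]` … `= 1`"). -/
  nrm_one : ∀ w ρ, nrm w ρ (one w) = 1
  /-- the Fréchet topology of `B_{E′_w}` ([J-III] §7.4 p.56 l.117–121 "compact (for the Fréchet-topology)"). -/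
  top : ∀ w, TopologicalSpace (B w)
  /-- each norm `|−|_{B,ρ}`, `0 < ρ < 1`, is continuous for the Fréchet topology (the topology is DEFINED by this
  family of norms, [FF18] §1.6; read in the proof of Cor. 7.4.1, p.57 l.3–8). -/
  continuous_nrm : ∀ w, ∀ ρ ∈ Set.Ioo (0 : ℝ) 1, @Continuous (B w) ℝ (top w) inferInstance (nrm w ρ)
  /-- `B^+_{L′_w} ⊂ B_{L′_w}` ([J-III] §5.2.2; [FF18] Déf. 1.10.7), read only through `nrm_le_one_of_mem_Bplus`. -/
  Bplus : ∀ w, Set (B w)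
  /-- "`B^+ = {x : |x|_1 ≤ 1}`" — the half of [J-IIp] Prop. 9.4.1's proof (p.30 l.22–31) that Cor. 7.4.2 invokes
  ("for each `w ∈ 𝕍^{odd,ss}`, and `ρ = 1`, one can apply [Joshi, 2023b, Proposition 9.4.1]", p.57 l.30–32). -/
  nrm_le_one_of_mem_Bplus : ∀ w x, x ∈ Bplus w → nrm w 1 x ≤ 1
  /-- the INDEX SET of the adelic theta-values locus: points `z ∈ Σ̃_{L′}` of Mochizuki's adelic Ansatz together
  with the admissible-lift data `(α, λ)` of Def. 6.4.3.1 (p.47 l.42–86: `Ξ^{z_1,…,z_{ℓ*}}_{λ,z,w} =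
  ([z_j] + i_j(λ) t_{K_{y′_j}})_j`, `λ ∈ 𝒪_E`), over which Def. 6.10.2 (p.52 l.56–70) forms
  `Θ̃^{B_{L′}}_Joshi = {Ξ_z = (Ξ_{z,w})_{w ∈ 𝕍_{L′}} : z ∈ Σ̃_{L′}} ⊂ B^{ℓ*}_{L′}` (type of; T-10/T-11 own its structure). -/
  Idx : Type
  /-- `z ↦ Ξ_z = (Ξ_{z,w})_{w ∈ 𝕍_{L′}}`, `Ξ_{z,w} = (Ξ_1, …, Ξ_{ℓ*}) ∈ B^{ℓ*}_{L′_w}` "is an `ℓ*`-tuple" (Def. 7.2.1,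
  p.53 l.42 – p.54 l.8; Def. 6.10.2). Coordinates `Fin ℓ*` = labels `j = 1, …, ℓ*`. -/
  Xi : Idx → ∀ w, Fin lstar → B w
  /-- [J-III] (6.5.1), p.48 l.17–19: "If `w ∈ 𝕍_{L′} − 𝕍^{odd,ss}`, then one defines `Ξ_{z,w} = ([1], …, [1]) ∈ B^{ℓ*}_E`." -/
  Xi_off : ∀ z w, w ∉ Vss → Xi z w = fun _ => one w
  /-- the index of the DISTINGUISHED ELEMENT `Ξ^α_{0,z}`, `z = z_Θ` the standard point of §4.4–4.5, `λ = 0`,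
  `α_w =` the `ℓ*`-tuple of Teichmüller lifts of the Tate parameters `(q_{w,j})_j` (proof of Thm. 7.3.1, p.55 l.36–66
  "the set `Θ̃^{B_{L′}}_Joshi` contains elements of the form `Ξ^α_{λ,z}` and especially … `Ξ^α_{0,z}`"; p.56 l.29–37);
  also the element "`Ξ_{z_Θ} ∈ Φ`" of §7.4 (1), p.56 l.115–116. -/
  std : Idx
  /-- `w ↦ |q_w|_{C_{p_w}}`: the absolute value of the Tate parameter `q_w` of `C/L′_w` at `w ∈ 𝕍^{odd,ss}` under the
  normalisation of Thm. 7.3.1 (p.55 l.3–9: "`|π_w|_{C_{p_w}} = p_w^{−1}` for any uniformizer `π_w ∈ 𝒪_{L′_w}`");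
  read only on `𝕍^{odd,ss}` (junk elsewhere). `|q_w^{1/2ℓ}|^{ℓ*}_{C_{p_w}} = (qAbs w)^{ℓ*/(2ℓ)}`, cf. `qBound`. -/
  qAbs : W → ℝ
  /-- a Tate parameter has `0 < |q_w|` … -/
  qAbs_pos : ∀ w ∈ Vss, 0 < qAbs w
  /-- … and `|q_w| < 1` (split multiplicative reduction). -/
  qAbs_lt_one : ∀ w ∈ Vss, qAbs w < 1

namespace AdelicThetaDatum

variable (D : AdelicThetaDatum)

/-- `ℓ = 2ℓ* + 1`, the prime of §3.3 (11) ([J-III] p.28 l.5–7). [claim: Joshi2024ATS3, status: disputed] -/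
def ell : ℕ := 2 * D.lstar + 1

/-- `ℓ ≥ 5` (§3.3 (11)), from `2 ≤ ℓ*`. [folklore] -/
theorem five_le_ell : 5 ≤ D.ell := by
  have := D.two_le_lstar; unfold ell; omega

/-- `0 < ℓ` as a real number. [folklore] -/
theorem ell_pos : (0 : ℝ) < D.ell := by
  have := D.five_le_ell; exact_mod_cast (by omega : 0 < D.ell)

/-- The ambient set `B^{ℓ*}_{L′} = ∏_{w ∈ 𝕍_{L′}} B^{ℓ*}_{L′_w}` in which the locus and the subsets `Φ` of §7.4 live
([J-III] Def. 6.10.2, p.52 l.60–70), as a type of families. [claim: Joshi2024ATS3, status: disputed] -/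
abbrev Tuple : Type := ∀ w : D.W, Fin D.lstar → D.B w

/-- **`Θ̃^{B_{L′}}_Joshi`**, the adelic theta-values locus with values in `B_{L′}` ([J-III] Def. 6.10.2, p.52 l.56–70:
"the set of all `Ξ_z = (Ξ_{z,w})_{w∈𝕍_{L′}} ∈ B^{ℓ*}_{L′}`, for each `z ∈ Σ̃_{L′}`"): the range of `Ξ` (slot T-11's
object, restated here only as `Set.range` over the interim carrier — merge-debt). [claim: Joshi2024ATS3, status: disputed] -/
def locus : Set D.Tuple := Set.range D.Xi

/-- `Ξ_z ∈ Θ̃^{B_{L′}}_Joshi`. [folklore] -/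
theorem Xi_mem_locus (z : D.Idx) : D.Xi z ∈ D.locus := ⟨z, rfl⟩

/-! ## 2. Definition 7.2.1: the sizes `|Ξ_{z,w}|_{B_{L′_w},ρ}` and `|Ξ_z|_{B_{L′},ρ}` (J3:Def7.2.1) -/

/-- **[J-III] Def. 7.2.1, (7.2.2)** (p.54 l.9–23): "Define the `(B_{L′_w},ρ)`-size of `Ξ_{z,w}` to be the product
`|Ξ_{z,w}|_{B_{L′_w},ρ} = |Ξ_1|_{B_{L′_w},ρ} · |Ξ_2|_{B_{L′_w},ρ} ··· |Ξ_{ℓ*}|_{B_{L′_w},ρ} ∈ ℝ` … the product of absolute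
values with respect to the norm `|−|_{B_{L′_w},ρ}` on `B_{L′_w}` given by [Fargues and Fontaine, 2018, Définition
1.10.2]" — for any `ℓ*`-tuple `x ∈ B^{ℓ*}_{L′_w}`. [claim: Joshi2024ATS3, status: disputed] -/
def localSize (w : D.W) (ρ : ℝ) (x : Fin D.lstar → D.B w) : ℝ := ∏ j, D.nrm w ρ (x j)

/-- **[J-III] Def. 7.2.1, (7.2.3)** (p.54 l.23–28): "Define the `(B_{L′},ρ)`-size of `Ξ_z` to be the product
`|Ξ_z|_{B_{L′},ρ} = ∏_{w∈𝕍_{L′}} |Ξ_{z,w}|_{B_{L′_w},ρ}`" — for any family `x ∈ B^{ℓ*}_{L′}`, as the formally infinite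
product `∏ᶠ` (junk value `1` on an infinite multiplicative support; on the locus the support is finite, Lem. 7.2.4
= `adelicSize_Xi_eq_prod`, so the junk value is never read there). [claim: Joshi2024ATS3, status: disputed] -/
def adelicSize (ρ : ℝ) (x : D.Tuple) : ℝ := ∏ᶠ w, D.localSize w ρ (x w)

/-- Local sizes are non-negative. [folklore] -/
theorem localSize_nonneg (w : D.W) (ρ : ℝ) (x : Fin D.lstar → D.B w) : 0 ≤ D.localSize w ρ x :=
  Finset.prod_nonneg fun j _ => D.nrm_nonneg w ρ (x j)

/-- The size of the trivial tuple `([1], …, [1])` is `1` (Lem. 6.5.2 applied coordinatewise, p.56 l.1–12: "for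
`w ∉ 𝕍^{odd,ss}` and for any `ρ ∈ [0, 1] ⊂ ℝ` one has `|Ξ^{α_w}_{0,z,w}|_{B_{L′_w},ρ} = 1`"). [folklore] -/
theorem localSize_one (w : D.W) (ρ : ℝ) : D.localSize w ρ (fun _ => D.one w) = 1 := by
  unfold localSize; simp [D.nrm_one]

/-- Adelic sizes are non-negative. [folklore] -/
theorem adelicSize_nonneg (ρ : ℝ) (x : D.Tuple) : 0 ≤ D.adelicSize ρ x :=
  finprod_nonneg fun w => D.localSize_nonneg w ρ (x w)

/-- A family which is `([1], …, [1])` off `𝕍^{odd,ss}` has multiplicative support inside `𝕍^{odd,ss}`. [folklore] -/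
theorem mulSupport_localSize_subset {x : D.Tuple} (hx : ∀ w, w ∉ D.Vss → x w = fun _ => D.one w) (ρ : ℝ) :
    Function.mulSupport (fun w => D.localSize w ρ (x w)) ⊆ (D.Vss : Set D.W) := by
  intro w hw
  by_contra h
  exact hw (by simp only [hx w h, D.localSize_one])

/-- For a family which is `([1], …, [1])` off `𝕍^{odd,ss}`, the `(B_{L′},ρ)`-size is the FINITE product over
`𝕍^{odd,ss}` (the computation of Lem. 7.2.4 / Rmk. 7.2.5). [folklore] -/
theorem adelicSize_eq_prod_of_off {x : D.Tuple} (hx : ∀ w, w ∉ D.Vss → x w = fun _ => D.one w) (ρ : ℝ) :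
    D.adelicSize ρ x = ∏ w ∈ D.Vss, D.localSize w ρ (x w) :=
  finprod_eq_prod_of_mulSupport_subset _ (D.mulSupport_localSize_subset hx ρ)

/-! ## 3. Lemma 7.2.4 and Remark 7.2.5 (J3:Lem7.2.4, J3:Rmk7.2.5) — DERIVED -/

/-- **[J-III] Lem. 7.2.4** (p.54 l.29–33): "For all `ρ ∈ (0, 1] ⊂ ℝ` and for all `z ∈ Σ̃_{L′}`, `|Ξ_z|_{B_{L′},ρ} < ∞`.
Proof. By the definition of `Ξ_z`, and by Lemma 6.5.2, for all `w ∈ 𝕍_{L′} − 𝕍^{odd,ss}`, `Ξ_{z,w}` has absolute value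
equal to one. Hence this product has a finite number of terms `≠ 1` and so is finite." TYPED AS: the multiplicative
support of `w ↦ |Ξ_{z,w}|_{B_{L′_w},ρ}` lies in the finite set `𝕍^{odd,ss}` — DERIVED from (6.5.1)/Lem. 6.5.2, at every
real `ρ`. [claim: Joshi2024ATS3, status: disputed] -/
theorem lem724 (ρ : ℝ) (z : D.Idx) :
    Function.mulSupport (fun w => D.localSize w ρ (D.Xi z w)) ⊆ (D.Vss : Set D.W) :=
  D.mulSupport_localSize_subset (D.Xi_off z) ρ

/-- **[J-III] Rmk. 7.2.5, (7.2.6)** (p.54 l.34–42): "It will be often convenient to group the product definition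
`|Ξ_z|_{B_{L′},ρ}` as follows: `|Ξ_z|_{B_{L′},ρ} = ∏_{p∈𝕍_ℚ} ∏_{w∈𝕍^{odd,ss}_p} |Ξ_{z,w}|_{B_{L′_w},ρ}`" — typed as the
product over `𝕍^{odd,ss}` (the further grouping by the rational prime `p` below `w` is `Finset.prod_fiberwise`, not
needed in §7.1–7.4). DERIVED. [claim: Joshi2024ATS3, status: disputed] -/
theorem adelicSize_Xi_eq_prod (ρ : ℝ) (z : D.Idx) :
    D.adelicSize ρ (D.Xi z) = ∏ w ∈ D.Vss, D.localSize w ρ (D.Xi z w) :=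
  D.adelicSize_eq_prod_of_off (D.Xi_off z) ρ

/-! ## 4. Definition 7.2.7: the sizes of the locus and of its subsets (J3:Def7.2.7, J3:Rmk7.2.10) -/

/-- **[J-III] Def. 7.2.7, (7.2.8)** (p.54 l.43–60): "For any `ρ ∈ (0, 1] ⊂ ℝ` let `|Θ̃^{B_{L′}}_Joshi|_{B_{L′},ρ} =
sup { |Ξ|_{B_{L′},ρ} : Ξ ∈ Θ̃^{B_{L′}}_Joshi }`" — for an arbitrary subset `Φ ⊂ B^{ℓ*}_{L′}` (§7.4 and Cor. 7.4.1 apply the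
symbol `|Φ|_{B_{L′}}` to subsets `Φ ⊂ Θ̃`), valued in `EReal = [−∞, +∞]` so that the supremum of an unbounded set of
sizes is `+∞` ("`< ∞`" in Cor. 7.4.1 is then `< ⊤`); `⊥` only for `Φ = ∅` (junk, documented). Rmk. 7.2.10 (p.54
l.77–79): "This was considered in [Joshi, 2023b] for a fixed p-adic field `E` … The above definition obviously deals
with the global case" (one-prime prototype: [J-IIp] Def. 8.6.1, E-t3). [claim: Joshi2024ATS3, status: disputed] -/
def sizeAt (Φ : Set D.Tuple) (ρ : ℝ) : EReal := ⨆ x ∈ Φ, ((D.adelicSize ρ x : ℝ) : EReal)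

/-- **[J-III] Def. 7.2.7, (7.2.9)** (p.54 l.61–76): "`|Θ̃^{B_{L′}}_Joshi|_{B_{L′}} = sup { |Ξ|_{B_{L′},ρ} : Ξ ∈ Θ̃^{B_{L′}}_Joshi`
and `ρ ∈ (0, 1] ⊂ ℝ }`" — for an arbitrary subset `Φ`, the supremum over `ρ ∈ (0,1]` of `sizeAt Φ ρ`.
[claim: Joshi2024ATS3, status: disputed] -/
def size (Φ : Set D.Tuple) : EReal := ⨆ ρ ∈ Set.Ioc (0 : ℝ) 1, D.sizeAt Φ ρ

/-- `|x|_{B_{L′},ρ} ≤ |Φ|_{B_{L′},ρ}` for `x ∈ Φ` (monotonicity of `sup`; the step (7.3.2) "By the definition of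
`|Θ̃^{B_{L′}}_Joshi|` one obtains `|Θ̃^{B_{L′}}_Joshi| ≥ |Ξ^α_{0,z}|_{B_{L′}}`", p.55 l.67–89). [folklore] -/
theorem adelicSize_le_sizeAt {Φ : Set D.Tuple} {x : D.Tuple} (hx : x ∈ Φ) (ρ : ℝ) :
    ((D.adelicSize ρ x : ℝ) : EReal) ≤ D.sizeAt Φ ρ :=
  le_iSup₂ (f := fun (x : D.Tuple) (_ : x ∈ Φ) => ((D.adelicSize ρ x : ℝ) : EReal)) x hx

/-- `|Φ|_{B_{L′},ρ} ≤ |Φ|_{B_{L′}}` for `ρ ∈ (0,1]`. [folklore] -/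
theorem sizeAt_le_size (Φ : Set D.Tuple) {ρ : ℝ} (hρ : ρ ∈ Set.Ioc (0 : ℝ) 1) : D.sizeAt Φ ρ ≤ D.size Φ :=
  le_iSup₂ (f := fun (ρ : ℝ) (_ : ρ ∈ Set.Ioc (0 : ℝ) 1) => D.sizeAt Φ ρ) ρ hρ

/-- (7.3.2) for a general member: `|x|_{B_{L′},ρ} ≤ |Φ|_{B_{L′}}` for `x ∈ Φ`, `ρ ∈ (0,1]`. [folklore] -/
theorem adelicSize_le_size {Φ : Set D.Tuple} {x : D.Tuple} (hx : x ∈ Φ) {ρ : ℝ} (hρ : ρ ∈ Set.Ioc (0 : ℝ) 1) :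
    ((D.adelicSize ρ x : ℝ) : EReal) ≤ D.size Φ :=
  (D.adelicSize_le_sizeAt hx ρ).trans (D.sizeAt_le_size Φ hρ)

/-- `sizeAt` is monotone in the subset. [folklore] -/
theorem sizeAt_mono {Φ Ψ : Set D.Tuple} (h : Φ ⊆ Ψ) (ρ : ℝ) : D.sizeAt Φ ρ ≤ D.sizeAt Ψ ρ :=
  iSup₂_le fun _ hx => D.adelicSize_le_sizeAt (h hx) ρ

/-- `size` is monotone in the subset. [folklore] -/
theorem size_mono {Φ Ψ : Set D.Tuple} (h : Φ ⊆ Ψ) : D.size Φ ≤ D.size Ψ :=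
  iSup₂_le fun ρ hρ => (D.sizeAt_mono h ρ).trans (D.sizeAt_le_size Ψ hρ)

/-- A uniform real bound on the sizes of the members bounds `sizeAt`. [folklore] -/
theorem sizeAt_le_coe {Φ : Set D.Tuple} {ρ C : ℝ} (h : ∀ x ∈ Φ, D.adelicSize ρ x ≤ C) :
    D.sizeAt Φ ρ ≤ ((C : ℝ) : EReal) :=
  iSup₂_le fun x hx => EReal.coe_le_coe_iff.2 (h x hx)

/-! ## 5. Theorem 7.3.1 — the fundamental theta-values estimate (J3:Thm7.3.1) -/

/-- The right-hand side of Thm. 7.3.1: `∏_{w ∈ 𝕍^{odd,ss}} |q_w^{1/2ℓ}|^{ℓ*}_{C_{p_w}} = ∏_w |q_w|^{ℓ*/(2ℓ)}` (p.55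
l.21–30; `|·|_{C_{p_w}}` multiplicative, so `|q^{1/2ℓ}|^{ℓ*} = |q|^{ℓ*/(2ℓ)}` for the chosen root).
[claim: Joshi2024ATS3, status: disputed] -/
def qBound : ℝ := ∏ w ∈ D.Vss, D.qAbs w ^ ((D.lstar : ℝ) / (2 * D.ell))

/-- The local factor `|q_w|^{ℓ*/(2ℓ)}` is positive on `𝕍^{odd,ss}`. [folklore] -/
theorem qFactor_pos {w : D.W} (hw : w ∈ D.Vss) : 0 < D.qAbs w ^ ((D.lstar : ℝ) / (2 * D.ell)) :=
  Real.rpow_pos_of_pos (D.qAbs_pos w hw) _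

/-- `0 < qBound`. [folklore] -/
theorem qBound_pos : 0 < D.qBound := Finset.prod_pos fun _ hw => D.qFactor_pos hw

/-- **[J-III] Theorem 7.3.1 (the fundamental theta-values estimate)** — "the global version of [Joshi, 2023b,
Theorem 9.2.1] and … my version of [Mochizuki, 2021c, Corollary 3.12]" (p.54 l.80–82); statement p.55 l.1–30,
verbatim: "Let `C/L` be an elliptic curve and suppose `ℓ` is an odd prime such that § 2.4, § 3.1, § 3.3 hold for
`C, L, ℓ`. Let `L′/L` be the finite extension of `L` defined in § 3.1, § 3.3. For any `w ∈ 𝕍^{odd,ss}`, let `p_w` be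
the rational prime lying below `w`. Choose a normalization of the `p_w`-adic valuation on `C_{p_w}` … such that
for any uniformizer `π_w ∈ 𝒪_{L′_w}` one has `|π_w|_{C_{p_w}} = p_w^{−1}`. Let `Θ̃^{B_{L′}}_Joshi` be the adelic
theta-values locus for the ring `B_{L′}` (defined in Definition 6.10.2). Then
`|Θ̃^{B_{L′}}_Joshi|_{B_{L′}} ≥ ∏_{w∈𝕍^{odd,ss}} |q_w^{1/2ℓ}|^{ℓ*}_{C_{p_w}}`." The hypotheses are the signature `D`;
the conclusion is typed. Name per plan/E/OBJECTS.tsv O-024. NOT asserted. FLAG (F-a): no "`ℓ ≫ 0`" in the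
statement; the proof's local step has it. -/
@[claim "Joshi2024ATS3" "disputed"]
def FundamentalEstimateBL : Prop := ((D.qBound : ℝ) : EReal) ≤ D.size D.locus

/-- **The local step of the proof of Thm. 7.3.1 at one `ρ`** (p.56 l.38–61, verbatim): "Moreover `Ξ^{α_w}_{0,z,w}`
runs through the local (i.e. `w`) component `Θ̃^{B_{L′_w}}_Joshi` of the adelic theta-values locus … Hence one can use
the method of proof of [Joshi, 2023b, Theorem 9.2.1] for each `w ∈ 𝕍^{odd,ss}` to establish that, for `ℓ ≫ 0`, one
has `|Ξ^{α_w}_{0,z,w}|_{B_{L′_w},ρ} > |q_w^{1/2ℓ}|^{ℓ*}_{C_{p_w}}`." — asserted by reference to a METHOD (the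
one-prime computation [J-IIp] Thm. 9.2.1, p.27–28: exponents `j²/ℓ*² ≤ 1`, E-t3), not to a stated lemma; THE
load-bearing step. Typed at a given `ρ` for the distinguished element `std = Ξ^α_{0,z_Θ}`. NOT asserted. -/
@[claim "Joshi2024ATS3" "disputed"]
def LocalThetaEstimateAt (ρ : ℝ) : Prop :=
  ∀ w ∈ D.Vss, D.qAbs w ^ ((D.lstar : ℝ) / (2 * D.ell)) < D.localSize w ρ (D.Xi D.std w)

/-- The local step as the proof USES it: at every `ρ ∈ (0, 1]` (the passage to the product, p.56 l.62–88, is written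
at a general `ρ` before "and so by definition", l.89–109). NOT asserted. -/
@[claim "Joshi2024ATS3" "disputed"]
def LocalThetaEstimate : Prop := ∀ ρ ∈ Set.Ioc (0 : ℝ) 1, D.LocalThetaEstimateAt ρ

/-- **Passage to the product** (p.56 l.62–88): from the local step at `ρ`,
`|Ξ^α_{0,z}|_{B_{L′},ρ} = ∏_{w∈𝕍_{L′}} |Ξ^{α_w}_{0,z,w}|_{B_{L′_w},ρ} ≥ ∏_{w∈𝕍^{odd,ss}} |q_w^{1/2ℓ}|^{ℓ*}_{C_{p_w}}` — DERIVED
(strictly, when `𝕍^{odd,ss} ≠ ∅`; see `qBound_lt_adelicSize_std`). [folklore] -/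
theorem qBound_le_adelicSize_std {ρ : ℝ} (h : D.LocalThetaEstimateAt ρ) :
    D.qBound ≤ D.adelicSize ρ (D.Xi D.std) := by
  rw [D.adelicSize_Xi_eq_prod]
  exact Finset.prod_le_prod (fun w hw => (D.qFactor_pos hw).le) fun w hw => (h w hw).le

/-- Strict passage to the product when `𝕍^{odd,ss}` is non-empty. [folklore] -/
theorem qBound_lt_adelicSize_std {ρ : ℝ} (h : D.LocalThetaEstimateAt ρ) (hne : D.Vss.Nonempty) :
    D.qBound < D.adelicSize ρ (D.Xi D.std) := by
  rw [D.adelicSize_Xi_eq_prod]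
  exact Finset.prod_lt_prod_of_nonempty (fun w hw => D.qFactor_pos hw) (fun w hw => h w hw) hne

/-- **Thm. 7.3.1 reduces EXACTLY to its local step at ONE `ρ ∈ (0,1]`** (p.55 l.36 – p.56 l.110: `Θ̃ ∋ Ξ^α_{0,z_Θ}`,
(7.3.2), the local step, passage to the product, "and so by definition … This proves the assertion"). DERIVED —
the kernel form of the reading "ONE exhibited element of the locus dominates the q-quantity" (the shape of
`Summit.ABC.IUTFork.Cor312Vol.VolumeTransport`, E-PLAN ruling R2). [folklore] -/
theorem fundamentalEstimateBL_of_localThetaEstimateAt {ρ : ℝ} (hρ : ρ ∈ Set.Ioc (0 : ℝ) 1)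
    (h : D.LocalThetaEstimateAt ρ) : D.FundamentalEstimateBL :=
  (EReal.coe_le_coe_iff.2 (D.qBound_le_adelicSize_std h)).trans
    (D.adelicSize_le_size (D.Xi_mem_locus D.std) hρ)

/-- Thm. 7.3.1 from the local step as printed (all `ρ`; only `ρ = 1` is used). [folklore] -/
theorem fundamentalEstimateBL_of_localThetaEstimate (h : D.LocalThetaEstimate) : D.FundamentalEstimateBL :=
  D.fundamentalEstimateBL_of_localThetaEstimateAt ⟨one_pos, le_rfl⟩ (h 1 ⟨one_pos, le_rfl⟩)

end AdelicThetaDatum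

end Summit.ABC.IUTFork.Joshi.ATS3

end
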